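import Summits.BirchSwinnertonDyer.BirchSwinnertonDyer.Theorems.TameQuarticSolventTprimeRankOneLowerOfKolyvaginCertificates
import HarnessLib

/-!
# Routes `TameQuarticSolvent` (crux 21391) / `TameQuarticManinParity` (crux #5 `TprimeRankOneLowerAtThree`, 23739):
# the Kolyvagin-certificate road in SUPPLY form — ONE admissible Heegner datum and ONE certificate per curve

Width seat `bsd-wall-tqs-p1-w2` g5 (cell `pub/bsd-wall`), 2026-08-28; `--supports stmt-BirchSwinnertonDyer-21391`, helper; sequel of
`TameQuarticSolventTprimeRankOneLowerOfKolyvaginCertificates.lean` (p595084). HONEST FRAMING: theorems only, CONDITIONAL on every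
displayed hypothesis; no definition, no named fact, no `sorry`; credits nothing toward 21391 / 23739; BSD is not proved by this.

p595084 keyed TQMP 23739 to Kolyvagin NON-divisibility certificates asked at EVERY admissible Heegner datum of every irreducible
(t′) rank-one curve (the shape kmc's row kernel consumes). The natural ITEM shape is weaker and existential — a SUPPLY, exactly
as the tree's Friedberg–Hoffstein supplies: for each curve ONE Heegner field `K` (`d_K` odd `< −4`, Heegner for `N_E`,
`L(E^{(d_K)},1) ≠ 0`), ONE frame `(Dt, H, ι, P = y_K)` and ONE derived Heegner point `P_n` at Kolyvagin primes of index
`≥ ord₃ ∏_ℓ c_ℓ(E) + v₃(c(Dt)) + 1` with `P_n ∉ 3^{that} E(K[n])`. This file records that the supply suffices (through the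
one-datum door `tprime_missingLowerBoundAt_three_of_kolyvaginCertificate_at_datum`):

* `tprime_missingLowerBoundAt_three_of_certificateSupply` — row-local;
* `tprimeRankOneLowerAtThree_of_certificateSupply_of_reducibleRows` — TQMP 23739 BY NAME ⟸ ToricPublishedInputs ∧ Matar–Nekovář
  Thm. 0.7 (lower half) ∧ TQS crux #4 `TprimeRankZeroUpperAtThree` (21393) ∧ `hsup` (the displayed SUPPLY text, = the statement a
  planner may file as «TprimeKolyvaginCertificateSupplyAtThree»; RESEARCH-open class-wide — it is the indivisibility half of the
  refined Kolyvagin conjecture at an additive `3` in its weakest, one-field form — and DECIDABLE per curve by a finite computation,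
  Jetchev–Lauter–Stein 2009 §4) ∧ `hred` (the lower half on the REDUCIBLE (t′) rank-one rows). TQS 21391 then follows by p588900.

References: [MatarNekovar2019] Thm. 0.7 (p. 456), §0.11 (p. 457); [JetchevLauterStein2009] §4; [GrossZagier1986] I.(6.3), Thm. I.(7.3);
[WZhang2014] Thm. 1.1, §3.8; [FriedbergHoffstein1995] Thm. B.
-/

noncomputable section

open scoped Classical

-- D-0017: single-problem summit, so `Summit.BirchSwinnertonDyer.BirchSwinnertonDyer.…` repeats a namespace BY DESIGN.
set_option linter.dupNamespace false

namespace Summit.BirchSwinnertonDyer.BirchSwinnertonDyer.Theorems.TprimeRankOneLowerKolyvagin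

open WeierstrassCurve NumberField IsDedekindDomain Field
  Literature.NumberTheory.EllipticCurves
  Literature.NumberTheory.EllipticCurves.ModularForms
  Literature.NumberTheory.EllipticCurves.Rank1Residual
  Literature.NumberTheory.EllipticCurves.Rank1Residual.Typed
  Summit.BirchSwinnertonDyer.Rank1Residual
  Summit.BirchSwinnertonDyer.Rank1Residual.Additive
  Summit.BirchSwinnertonDyer.Rank1Residual.X11b
  Summit.BirchSwinnertonDyer.Rank1Residual.X11b.Three
  Summit.BirchSwinnertonDyer.BirchSwinnertonDyer.Theses.UniversalToricDescent

/-- **The (t′) rank-one LOWER half at `3` from a certificate SUPPLY (one Heegner field, one frame, one certificate), row-local.**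
For ONE globally minimal non-CM `W`, additive of class (t′) at `3`, `ρ̄_{E,3}` irreducible, `r_an = 1`: IF there exist a level
`N = N_E`, an imaginary quadratic Heegner field `K` for `N` with `d_K` odd, `d_K < −4`, `L(E^{(d_K)},1) ≠ 0`, a frame `(Dt, H, ι)`
with `P ∈ E(K)` mapping to its Heegner point, and ONE Kolyvagin NON-divisibility certificate at depth
`ord₃ ∏_ℓ c_ℓ(E) + v₃(c(Dt)) + 1`, THEN `Typed.MissingLowerBoundAt W 3` — given ToricPublishedInputs, Matar–Nekovář Thm. 0.7 (lower
half) and TQS crux #4 (21393) at the twist. One-datum door of p595084, unpacked. CONDITIONAL; closes nothing.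
[cite: MatarNekovar2019, Thm. 0.7 (p. 456) and §0.11 (p. 457)] [cite: JetchevLauterStein2009, §4] -/
theorem tprime_missingLowerBoundAt_three_of_certificateSupply (hF : ToricPublishedInputs)
    (hMNlow : MatarNekovar2019.thm07_pow_dvd_card_sha_primary_of_certificate_of_irreducible)
    (hU0 : Summit.BirchSwinnertonDyer.BirchSwinnertonDyer.Theses.TameQuarticSolvent.TprimeRankZeroUpperAtThree)
    (W : WeierstrassCurve ℚ) [W.IsElliptic] [W.IsGloballyMinimal] (hCM : ¬ W.HasCM) (hadd : Addv W 3)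
    (hT : SubTprime W 3) (hirr : W.HasIrreducibleModPGaloisRep 3) (hr : W.analyticRank = 1)
    (hsup : ∃ (N : ℕ) (_ : NeZero N) (_ : W.conductorNorm ℤ = N) (K : Type) (_ : Field K) (_ : NumberField K)
      (Dt : ModularParametrizationData W N) (H : HeegnerDatum N (NumberField.discr K)) (ι : K →+* ℂ)
      (P : (W.baseChange K).toAffine.Point),
      IsImaginaryQuadratic K ∧ SatisfiesHeegnerHypothesis N K ∧ Odd (NumberField.discr K) ∧ NumberField.discr K < -4 ∧
      (W.quadraticTwist (NumberField.discr K : ℚ)).entireLFunction 1 ≠ 0 ∧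
      WeierstrassCurve.Affine.Point.map ι.toRatAlgHom P = heegnerPointComplex Dt H ∧
      ∃ (n : ℕ) (d : KolyvaginHeegnerData Dt H.β ι n), Squarefree n ∧
        (∀ ℓ ∈ n.primeFactors, Zhang2014.IsKolyvaginPrime N W K 3 ℓ ∧
          padicValNat 3 W.tamagawaProduct + padicValNat 3 Dt.c.natAbs + 1 ≤ Zhang2014.kolyvaginIndex W 3 ℓ) ∧
        ¬ Koly.PDiv d 3 (padicValNat 3 W.tamagawaProduct + padicValNat 3 Dt.c.natAbs + 1)) :
    MissingLowerBoundAt W 3 := by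
  obtain ⟨N, _, hN, K, _, _, Dt, H, ι, P, hK, hHN, hodd, hd4, hLd, hP, hcert⟩ := hsup
  subst hN
  exact tprime_missingLowerBoundAt_three_of_kolyvaginCertificate_at_datum hF hMNlow hU0 W hCM hadd hT hirr hr K hK hHN hodd
    hd4 hLd Dt H ι P hP hcert

/-- **TQMP crux #5 `TprimeRankOneLowerAtThree` (stmt-BirchSwinnertonDyer-23739) BY NAME from a certificate SUPPLY on the
irreducible (t′) rank-one rows and the lower half on the reducible ones.** Hypotheses: ToricPublishedInputs; Matar–Nekovář Thm. 0.7
(lower half); TQS crux #4 `TprimeRankZeroUpperAtThree` (stmt-21393); `hsup` — DISPLAYED SUPPLY TEXT (the statement a planner may file,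
«TprimeKolyvaginCertificateSupplyAtThree»): every non-CM globally minimal (t′) curve of analytic rank one with `ρ̄_{E,3}` irreducible
admits ONE Heegner datum (`d_K` odd `< −4`, Heegner for `N_E`, `L(E^{(d_K)},1) ≠ 0`) carrying ONE Kolyvagin NON-divisibility
certificate at depth `ord₃ ∏_ℓ c_ℓ(E) + v₃(c(Dt)) + 1` (the indivisibility half of the refined Kolyvagin conjecture at the additive
`3`, one-field form; research-open class-wide, finitely decidable per curve); `hred` — the lower half on the (t′) rank-one rows with
`ρ̄_{E,3}` reducible (displayed residual). The TQS deciding crux `SolventPairLowerBound` (21391) then follows BY NAME by p588900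
`SolventPairLowerBound.solventPairLowerBound_of_tprimeRankOneLowerAtThree_of_tameLowerHalfRankZero`. CONDITIONAL; credits nothing.
[cite: MatarNekovar2019, Thm. 0.7 (p. 456) and §0.11 (p. 457)] [cite: WZhang2014, Thm. 1.1 and §3.8]
[cite: JetchevLauterStein2009, §4] -/
theorem tprimeRankOneLowerAtThree_of_certificateSupply_of_reducibleRows (hF : ToricPublishedInputs)
    (hMNlow : MatarNekovar2019.thm07_pow_dvd_card_sha_primary_of_certificate_of_irreducible)
    (hU0 : Summit.BirchSwinnertonDyer.BirchSwinnertonDyer.Theses.TameQuarticSolvent.TprimeRankZeroUpperAtThree)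
    (hsup : ∀ (W : WeierstrassCurve ℚ) [W.IsElliptic] [W.IsGloballyMinimal], ¬ W.HasCM → Addv W 3 → SubTprime W 3 →
      W.HasIrreducibleModPGaloisRep 3 → W.analyticRank = 1 →
      ∃ (N : ℕ) (_ : NeZero N) (_ : W.conductorNorm ℤ = N) (K : Type) (_ : Field K) (_ : NumberField K)
        (Dt : ModularParametrizationData W N) (H : HeegnerDatum N (NumberField.discr K)) (ι : K →+* ℂ)
        (P : (W.baseChange K).toAffine.Point),
        IsImaginaryQuadratic K ∧ SatisfiesHeegnerHypothesis N K ∧ Odd (NumberField.discr K) ∧ NumberField.discr K < -4 ∧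
        (W.quadraticTwist (NumberField.discr K : ℚ)).entireLFunction 1 ≠ 0 ∧
        WeierstrassCurve.Affine.Point.map ι.toRatAlgHom P = heegnerPointComplex Dt H ∧
        ∃ (n : ℕ) (d : KolyvaginHeegnerData Dt H.β ι n), Squarefree n ∧
          (∀ ℓ ∈ n.primeFactors, Zhang2014.IsKolyvaginPrime N W K 3 ℓ ∧
            padicValNat 3 W.tamagawaProduct + padicValNat 3 Dt.c.natAbs + 1 ≤ Zhang2014.kolyvaginIndex W 3 ℓ) ∧
          ¬ Koly.PDiv d 3 (padicValNat 3 W.tamagawaProduct + padicValNat 3 Dt.c.natAbs + 1))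
    (hred : ∀ (W : WeierstrassCurve ℚ) [W.IsElliptic] [W.IsGloballyMinimal], ¬ W.HasCM → Addv W 3 → SubTprime W 3 →
      ¬ W.HasIrreducibleModPGaloisRep 3 → W.analyticRank = 1 → MissingLowerBoundAt W 3) :
    Summit.BirchSwinnertonDyer.BirchSwinnertonDyer.Theses.TameQuarticManinParity.TprimeRankOneLowerAtThree := by
  intro W _ _ hCM hadd hT hr
  by_cases hirr : W.HasIrreducibleModPGaloisRep 3
  · exact tprime_missingLowerBoundAt_three_of_certificateSupply hF hMNlow hU0 W hCM hadd hT hirr hr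
      (hsup W hCM hadd hT hirr hr)
  · exact hred W hCM hadd hT hirr hr

end Summit.BirchSwinnertonDyer.BirchSwinnertonDyer.Theorems.TprimeRankOneLowerKolyvagin

end
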